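import Literature.AlgebraicGeometry.AbelianSchemes.AbelianSchemeSteinOfNoetherian
import Literature.AlgebraicGeometry.AbelianSchemes.RigidifiedAutOfReducedBase
import Literature.AlgebraicGeometry.AbelianVarieties.StructureSheafSemiHomogeneous
import Literature.AlgebraicGeometry.Modules.PullbackClosedImmersionCokernel
import HarnessLib

/-!
# Normalised isomorphisms of rigidified line bundles on `A_T → T`, ANY test scheme `T` over a locally Noetherian base

Layer `Literature/AlgebraicGeometry/AbelianSchemes`, namespace `Literature.AlgebraicGeometry.AbelianSchemes.AbelianSchemeOver`.
THEOREMS ONLY (no definition, no named fact, no instance, no notation, no `sorry`).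

[MumfordAV1970, §13, proof of the Theorem on p. 125]: an isomorphism of line bundles on `X × T` which are rigidified along the
zero section can be NORMALISED (made compatible with the rigidifications), and «normalised isomorphisms are unique» because
`p_* 𝒪_{X × T} = 𝒪_T` ([MumfordAV1970, §5 Cor. 6]); hence local normalised isomorphisms glue.  ★
`AbelianSchemes/RigidifiedAutOfReducedBase` proves the uniqueness half for an abelian scheme `A → T` over a REDUCED locally
Noetherian `T` (the Stein property there is ★ `AbelianSchemeSteinOfReduced`).  THIS FILE removes both hypotheses on the TEST
scheme: for an abelian scheme `A → S` over a LOCALLY NOETHERIAN `S` and ANY `f : T ⟶ S`, the base change `A_T → T` is Stein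
(★ `AbelianSchemeSteinOfNoetherian.baseChange_appTop_bijective [IsLocallyNoetherian S] (g : T ⟶ S)` — EGA III (7.8.6) /
[GortzWedhorn2023, Cor. 24.63]), which is all the argument uses.

For `E₁ E₂` rank-one `𝒪_{A_T}`-modules with CHOSEN rigidifications `rₖ : ε_T^* Eₖ ≅ 𝒪_T` (the data of ★ `RigidifiedLineBundle`,
[MilneAV2008, I §8] condition (b′)):

* §1 `appTop_baseChange_eq_of_unitSection_appTop_eq`, `eq_appTop_unitSection_appTop_baseChange` — a global function on `A_T`
  is determined by (indeed is the pull-back of) its restriction along the unit section `ε_T` (Stein on global sections);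
* §2 `hom_baseChange_eq_id_of_pullback_unitSection_map_eq_id`, `hom_baseChange_eq_of_pullback_unitSection_map_eq`,
  `iso_baseChange_eq_of_pullback_unitSection_map_eq` — an endomorphism of a line bundle on `A_T` which is `𝟙` along `ε_T` IS
  `𝟙` (★ `Modules.exists_unique_eq_globalScalar` + ★ `Modules.pullback_map_globalScalar` + §1); two isomorphisms of line bundles
  with the same restriction along `ε_T` coincide — ★ `iso_eq_of_pullback_unitSection_map_eq` with `[IsReduced T]
  [IsLocallyNoetherian T]` replaced by `[IsLocallyNoetherian S]`, `T` arbitrary;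
* §3 **`exists_iso_pullback_unitSection_map_comp_eq`** (NORMALISATION: if `E₁ ≅ E₂` at all, some isomorphism `φ` satisfies
  `ε_T^*φ ≫ r₂ = r₁` — rescale by `π^♯` of the unit `r₁⁻¹ ≫ ε_T^*α ≫ r₂ ∈ Aut(𝒪_T) = Γ(T, 𝒪_T)ˣ`, the pattern of ★
  `RigidDescentAlongUnitSection.exists_iso_restrictAlong_eq`), **`existsUnique_iso_pullback_unitSection_map_comp_eq`**
  (normalised isomorphisms EXIST UNIQUELY) and **`iso_trans_eq_of_pullback_unitSection_map_comp_eq`** (normalised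
  isomorphisms satisfy the COCYCLE IDENTITY `φ₁₂ ≫ φ₂₃ = φ₁₃` for free).

Cell hodgecm-mathlib (D-0151), FLOOR 0 programme P1, sub-line `F0/P1/Lines/F3DualAbelianScheme` (author of record B-plan1
(g19)): §3 is the typed letter (Z2) `stub_F3Z2` of `typers/B-typ04/F3/STUBMENU-F3Z-letters.v1.B-typ04g15.lean` (7eeec22a)
token for token with `S`-universe `u` (the stub closes by `exact existsUnique_iso_pullback_unitSection_map_comp_eq A f h₁ h₂ r₁ r₂`),
the «cocycle for free» input (Z2) of the dual-pair Zariski gluing (B-p06 (g14) census `CENSUS-DualPairZariskiGluing` 4119b73a,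
(Z1) → (Z2) → (Z3)); consumers: the Poincaré-sheaf cocycle on the dual charts `A × Âᵢⱼₖ → Âᵢⱼₖ` and the existence half of
`DualPair.universal` for the glued pair at arbitrary test schemes.  Count-neutral; HC_CM is proved only modulo the 7 printed
citations until rung 0 closes; nothing here is about HC.

Mathlib searched (pin): `cancel_mono`, `Functor.map_comp`, `Iso.ext`; Mathlib has no abelian schemes, no rigidified
Picard functor and no Stein property of proper morphisms.

## References
* [MumfordAV1970] D. Mumford, *Abelian Varieties* (1970), §5 Cor. 6 (p. 54) (`p_*𝒪 = 𝒪`), §13 (Thm. p. 125 and its proof: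
  normalised isomorphisms of rigidified line bundles).
* [MilneAV2008] J. S. Milne, *Abelian Varieties* (v2.00, 2008), I §8 pp. 36–37 (rigidified families, condition (b′)).
* [GortzWedhorn2023] U. Görtz, T. Wedhorn, *Algebraic Geometry II: Cohomology of Schemes* (2023), Cor. 24.63 (p. 404)
  (cohomological flatness in dimension `0`), Thm. 24.66 / Lemma 24.67 (p. 406).
* [Hartshorne1977] R. Hartshorne, *Algebraic Geometry*, GTM 52 (1977), II Ex. 5.1 (b) (p. 123).
-/

set_option autoImplicit false

-- `Scheme.Modules` / `SheafOfModules` are not reducible (as in Mathlib's `AlgebraicGeometry/Modules/Sheaf.lean` and ★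
-- `AbelianSchemes/PoincareUniversalLocality`).
set_option backward.isDefEq.respectTransparency false

noncomputable section

universe u

open CategoryTheory CategoryTheory.Limits AlgebraicGeometry TopologicalSpace
open Literature.AlgebraicGeometry.Modules Literature.AlgebraicGeometry.Motives

namespace Literature.AlgebraicGeometry.AbelianSchemes

namespace AbelianSchemeOver

variable {S : Scheme.{u}} [IsLocallyNoetherian S] (A : AbelianSchemeOver S) {T : Scheme.{u}} (f : T ⟶ S)

/-! ## §1 Global functions on `A_T` are read along the unit section (`A_T → T` Stein, ANY `T`) -/

omit [IsLocallyNoetherian S] in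
/-- `ε_T^♯ (π_T^♯ c) = c` for the base change `π_T : A_T → T` and its unit section `ε_T` (`ε_T ≫ π_T = 𝟙`).
[cite: MumfordFogartyKirwan1994, Ch. 6 §1 Definition 6.1 (p. 115)] -/
theorem unitSection_appTop_hom_appTop_baseChange (c : Γ(T, ⊤)) :
    (A.baseChange f).unitSection.appTop ((A.baseChange f).X.hom.appTop c) = c := by
  rw [← CommRingCat.comp_apply (A.baseChange f).X.hom.appTop, ← Scheme.Hom.comp_appTop,
    (A.baseChange f).unitSection_comp_hom, Scheme.Hom.id_appTop]
  rfl

/-- **Global functions on `A_T` are determined by their restriction along the unit section**, for EVERY test scheme `T`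
over a locally Noetherian `S`: `Γ(A_T, 𝒪) = π_T^♯ Γ(T, 𝒪_T)` (★ `baseChange_appTop_bijective`, the Stein property of
`A_T → T`, [MumfordAV1970, §5 Cor. 6]) and `ε_T^♯ ∘ π_T^♯ = id`. [cite: MumfordAV1970, §5 Cor. 6 (p. 54)]
[cite: GortzWedhorn2023, Cor. 24.63 (p. 404)] -/
theorem appTop_baseChange_eq_of_unitSection_appTop_eq (u v : Γ((A.baseChange f).X.left, ⊤))
    (h : (A.baseChange f).unitSection.appTop u = (A.baseChange f).unitSection.appTop v) : u = v := by
  obtain ⟨a, rfl⟩ := (A.baseChange_appTop_bijective f).2 u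
  obtain ⟨b, rfl⟩ := (A.baseChange_appTop_bijective f).2 v
  rw [A.unitSection_appTop_hom_appTop_baseChange f, A.unitSection_appTop_hom_appTop_baseChange f] at h
  rw [h]

/-- **Every global function on `A_T` is the pull-back of its restriction along the unit section**: `w = π_T^♯ (ε_T^♯ w)`,
for every `T` over a locally Noetherian `S`. [cite: MumfordAV1970, §5 Cor. 6 (p. 54)] [cite: GortzWedhorn2023, Cor. 24.63 (p. 404)] -/
theorem eq_appTop_unitSection_appTop_baseChange (w : Γ((A.baseChange f).X.left, ⊤)) :
    w = (A.baseChange f).X.hom.appTop ((A.baseChange f).unitSection.appTop w) :=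
  A.appTop_baseChange_eq_of_unitSection_appTop_eq f _ _ (A.unitSection_appTop_hom_appTop_baseChange f _).symm

/-! ## §2 Rigidified endomorphisms and isomorphisms of line bundles on `A_T` are trivial (ANY `T`) -/

/-- **An endomorphism of a line bundle on `A_T` whose restriction along the unit section is the identity IS the identity**,
for every `T` over a locally Noetherian `S`: `α = a · 𝟙` for a global function `a` (★ `exists_unique_eq_globalScalar`),
`ε_T^*α = ε_T^♯(a) · 𝟙 = 𝟙` forces `ε_T^♯ a = ε_T^♯ 1` (★ `pullback_map_globalScalar`, ★ `eq_of_globalScalar_eq`), hence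
`a = 1` (§1). [cite: MumfordAV1970, §13 (p. 125)] [cite: Hartshorne1977, II Ex. 5.1 (b) (p. 123)] -/
theorem hom_baseChange_eq_id_of_pullback_unitSection_map_eq_id {E : (A.baseChange f).X.left.Modules} (h₁ : HasRank E 1)
    (α : E ⟶ E) (h : (Scheme.Modules.pullback (A.baseChange f).unitSection).map α = 𝟙 _) : α = 𝟙 E := by
  obtain ⟨a, ha, -⟩ := exists_unique_eq_globalScalar h₁ α
  rw [ha] at h ⊢
  rw [pullback_map_globalScalar, ← globalScalar_one] at h
  have ha1 : (A.baseChange f).unitSection.appTop a = (A.baseChange f).unitSection.appTop 1 :=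
    (eq_of_globalScalar_eq Nat.one_pos (hasRank_pullback _ h₁) h).trans (map_one _).symm
  rw [A.appTop_baseChange_eq_of_unitSection_appTop_eq f a 1 ha1, globalScalar_one]

/-- **Two morphisms of line bundles `E → E′` on `A_T`, the second an isomorphism, with the same restriction along the unit
section are equal** (every `T` over a locally Noetherian `S`): apply `hom_baseChange_eq_id_of_pullback_unitSection_map_eq_id`
to `α ≫ β⁻¹`. [cite: MumfordAV1970, §13 (p. 125)] [cite: MilneAV2008, I §8 pp. 36–37] -/
theorem hom_baseChange_eq_of_pullback_unitSection_map_eq {E E' : (A.baseChange f).X.left.Modules} (h₁ : HasRank E 1)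
    (α β : E ⟶ E') [IsIso β]
    (h : (Scheme.Modules.pullback (A.baseChange f).unitSection).map α =
      (Scheme.Modules.pullback (A.baseChange f).unitSection).map β) : α = β := by
  have hid : α ≫ inv β = 𝟙 E := by
    refine A.hom_baseChange_eq_id_of_pullback_unitSection_map_eq_id f h₁ (α ≫ inv β) ?_
    rw [Functor.map_comp, h, ← Functor.map_comp, IsIso.hom_inv_id]
    exact (Scheme.Modules.pullback (A.baseChange f).unitSection).map_id E
  simpa only [Category.assoc, IsIso.inv_hom_id, Category.comp_id, Category.id_comp] using congrArg (· ≫ β) hid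

/-- **RIGIDIFIED ISOMORPHISMS of line bundles on `A_T` ARE UNIQUE**, for every test scheme `T` over a locally Noetherian `S`:
two isomorphisms `E ≅ E′` with the same restriction along the unit section coincide ([MumfordAV1970, §13 p. 125]
«normalised isomorphisms are unique»; ★ `iso_eq_of_pullback_unitSection_map_eq` without `IsReduced`/`IsLocallyNoetherian` on
`T`). [cite: MumfordAV1970, §13 (p. 125)] [cite: MilneAV2008, I §8 pp. 36–37] -/
theorem iso_baseChange_eq_of_pullback_unitSection_map_eq {E E' : (A.baseChange f).X.left.Modules} (h₁ : HasRank E 1)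
    (α β : E ≅ E')
    (h : (Scheme.Modules.pullback (A.baseChange f).unitSection).map α.hom =
      (Scheme.Modules.pullback (A.baseChange f).unitSection).map β.hom) : α = β :=
  Iso.ext (A.hom_baseChange_eq_of_pullback_unitSection_map_eq f h₁ α.hom β.hom h)

/-! ## §3 Normalisation: normalised isomorphisms exist uniquely; the cocycle identity for free -/

/-- **NORMALISATION of an isomorphism of rigidified line bundles** ([MumfordAV1970, §13 p. 125], any base): given CHOSEN
rigidifications `rₖ : ε_T^* Eₖ ≅ 𝒪_T` of two rank-one modules on `A_T` and ANY isomorphism `α : E₁ ≅ E₂`, there is an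
isomorphism `φ : E₁ ≅ E₂` with `ε_T^*φ ≫ r₂ = r₁`: the defect `r₁⁻¹ ≫ ε_T^*α ≫ r₂` is an automorphism of `𝒪_T`, i.e. a unit
`d ∈ Γ(T, 𝒪_T)` (★ `exists_unique_eq_globalScalar` on the rank-one `𝒪_T`), and `φ := α ≫ (π_T^♯ d⁻¹ · )` works because
`ε_T^*(π_T^♯ c · ) = c ·` (★ `pullback_map_globalScalar`, `ε_T ≫ π_T = 𝟙`).  No hypothesis on `S` or `T` is used here.
[cite: MumfordAV1970, §13 (p. 125)] [cite: MilneAV2008, I §8 pp. 36–37] -/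
theorem exists_iso_pullback_unitSection_map_comp_eq {S : Scheme.{u}} (A : AbelianSchemeOver S) {T : Scheme.{u}}
    (f : T ⟶ S) {E₁ E₂ : (A.baseChange f).X.left.Modules}
    (r₁ : (Scheme.Modules.pullback (A.baseChange f).unitSection).obj E₁ ≅ SheafOfModules.unit _)
    (r₂ : (Scheme.Modules.pullback (A.baseChange f).unitSection).obj E₂ ≅ SheafOfModules.unit _) (α : E₁ ≅ E₂) :
    ∃ φ : E₁ ≅ E₂, (Scheme.Modules.pullback (A.baseChange f).unitSection).map φ.hom ≫ r₂.hom = r₁.hom := by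
  have hO : HasRank (SheafOfModules.unit T.ringCatSheaf : T.Modules) 1 := AbelianVarieties.hasRank_unit_one
  -- the defect of `α` along the unit section: an automorphism of `𝒪_T`, i.e. a unit `d` of `Γ(T, 𝒪_T)`
  let δ : (SheafOfModules.unit T.ringCatSheaf : T.Modules) ≅ SheafOfModules.unit _ :=
    r₁.symm ≪≫ (Scheme.Modules.pullback (A.baseChange f).unitSection).mapIso α ≪≫ r₂
  obtain ⟨d, hd, -⟩ := exists_unique_eq_globalScalar hO δ.hom
  obtain ⟨d', hd', -⟩ := exists_unique_eq_globalScalar hO δ.inv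
  have hdd' : d * d' = 1 := by
    refine eq_of_globalScalar_eq Nat.one_pos hO ?_
    rw [globalScalar_mul, ← hd, ← hd', globalScalar_one]
    exact δ.inv_hom_id
  have hd'd : d' * d = 1 := by rw [mul_comm]; exact hdd'
  -- rescale `α` by `π_T^♯ d'` on `E₂`
  let eD : E₂ ≅ E₂ :=
    { hom := globalScalar E₂ ((A.baseChange f).X.hom.appTop d')
      inv := globalScalar E₂ ((A.baseChange f).X.hom.appTop d)
      hom_inv_id := by rw [← globalScalar_mul, ← map_mul, hdd', map_one, globalScalar_one]
      inv_hom_id := by rw [← globalScalar_mul, ← map_mul, hd'd, map_one, globalScalar_one] }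
  have heD : eD.hom = globalScalar E₂ ((A.baseChange f).X.hom.appTop d') := rfl
  have hα : (Scheme.Modules.pullback (A.baseChange f).unitSection).map α.hom ≫ r₂.hom = r₁.hom ≫ δ.hom := by
    simp only [δ, Iso.trans_hom, Iso.symm_hom, Functor.mapIso_hom, Iso.hom_inv_id_assoc]
  refine ⟨α ≪≫ eD, ?_⟩
  rw [Iso.trans_hom, Functor.map_comp, Category.assoc, heD,
    pullback_map_globalScalar ((A.baseChange f).unitSection) E₂ ((A.baseChange f).X.hom.appTop d'),
    A.unitSection_appTop_hom_appTop_baseChange f, globalScalar_comp r₂.hom d', ← Category.assoc, hα, Category.assoc, hd,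
    ← globalScalar_mul, hd'd, globalScalar_one, Category.comp_id]

/-- **NORMALISED ISOMORPHISMS OF RIGIDIFIED LINE BUNDLES EXIST UNIQUELY on `A_T → T`, `T` ANY scheme over a locally Noetherian
`S`** ([MumfordAV1970, §13 p. 125]): for rank-one modules `E₁ E₂` on `A_T` with chosen rigidifications `rₖ : ε_T^* Eₖ ≅ 𝒪_T`,
if `E₁ ≅ E₂` at all then there is a UNIQUE `φ : E₁ ≅ E₂` with `ε_T^*φ ≫ r₂ = r₁` (existence
`exists_iso_pullback_unitSection_map_comp_eq`, any base; uniqueness `iso_baseChange_eq_of_pullback_unitSection_map_eq`, Stein).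
This is the typed letter (Z2) `stub_F3Z2` of the FLOOR 0 sub-line `F3DualAbelianScheme` (B-typ04 (g15) 7eeec22a) token for
token; the rigidified Picard functor is separated for the Zariski topology by exactly this statement ([GortzWedhorn2023,
Thm. 24.66 / Lemma 24.67]). [cite: MumfordAV1970, §13 (p. 125)] [cite: GortzWedhorn2023, Thm. 24.66 and Lemma 24.67 (p. 406)] -/
theorem existsUnique_iso_pullback_unitSection_map_comp_eq {E₁ E₂ : (A.baseChange f).X.left.Modules} (h₁ : HasRank E₁ 1)
    (_h₂ : HasRank E₂ 1)
    (r₁ : (Scheme.Modules.pullback (A.baseChange f).unitSection).obj E₁ ≅ SheafOfModules.unit _)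
    (r₂ : (Scheme.Modules.pullback (A.baseChange f).unitSection).obj E₂ ≅ SheafOfModules.unit _)
    (hα : Nonempty (E₁ ≅ E₂)) :
    ∃! φ : E₁ ≅ E₂, (Scheme.Modules.pullback (A.baseChange f).unitSection).map φ.hom ≫ r₂.hom = r₁.hom := by
  obtain ⟨φ, hφ⟩ := A.exists_iso_pullback_unitSection_map_comp_eq f r₁ r₂ hα.some
  refine ⟨φ, hφ, fun ψ hψ => A.iso_baseChange_eq_of_pullback_unitSection_map_eq f h₁ ψ φ ?_⟩
  rw [← cancel_mono r₂.hom, hψ, hφ]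

/-- **Normalised isomorphisms satisfy the COCYCLE IDENTITY for free**: for three rank-one modules `(Eₖ, rₖ)` on `A_T → T`
rigidified along the unit section (`T` any scheme over the locally Noetherian `S`) and isomorphisms `φ₁₂`, `φ₂₃`, `φ₁₃`
normalised by `ε_T^*φᵢⱼ ≫ rⱼ = rᵢ`, one has `φ₁₂ ≫ φ₂₃ = φ₁₃` — both sides are normalised isomorphisms `E₁ ≅ E₃`
(`existsUnique_iso_pullback_unitSection_map_comp_eq`).  This is the `hcoc` input of the rank-one gluing (Z1) in the dual-pair
Zariski gluing (charts `A × Âᵢⱼₖ → Âᵢⱼₖ`). [cite: MumfordAV1970, §13 (p. 125)] [cite: GortzWedhorn2023, Lemma 24.67 (p. 406)] -/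
theorem iso_trans_eq_of_pullback_unitSection_map_comp_eq {E₁ E₂ E₃ : (A.baseChange f).X.left.Modules} (h₁ : HasRank E₁ 1)
    (h₃ : HasRank E₃ 1)
    (r₁ : (Scheme.Modules.pullback (A.baseChange f).unitSection).obj E₁ ≅ SheafOfModules.unit _)
    (r₂ : (Scheme.Modules.pullback (A.baseChange f).unitSection).obj E₂ ≅ SheafOfModules.unit _)
    (r₃ : (Scheme.Modules.pullback (A.baseChange f).unitSection).obj E₃ ≅ SheafOfModules.unit _)
    (φ₁₂ : E₁ ≅ E₂) (φ₂₃ : E₂ ≅ E₃) (φ₁₃ : E₁ ≅ E₃)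
    (n₁₂ : (Scheme.Modules.pullback (A.baseChange f).unitSection).map φ₁₂.hom ≫ r₂.hom = r₁.hom)
    (n₂₃ : (Scheme.Modules.pullback (A.baseChange f).unitSection).map φ₂₃.hom ≫ r₃.hom = r₂.hom)
    (n₁₃ : (Scheme.Modules.pullback (A.baseChange f).unitSection).map φ₁₃.hom ≫ r₃.hom = r₁.hom) :
    φ₁₂ ≪≫ φ₂₃ = φ₁₃ := by
  have n : (Scheme.Modules.pullback (A.baseChange f).unitSection).map (φ₁₂ ≪≫ φ₂₃).hom ≫ r₃.hom = r₁.hom := by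
    rw [Iso.trans_hom, Functor.map_comp, Category.assoc, n₂₃, n₁₂]
  exact (A.existsUnique_iso_pullback_unitSection_map_comp_eq f h₁ h₃ r₁ r₃ ⟨φ₁₃⟩).unique n n₁₃

end AbelianSchemeOver

end Literature.AlgebraicGeometry.AbelianSchemes

end
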